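import Mathlib
import Literature.Probability.RandomPlanarGeometry.LoopEnsembleSpace
import Literature.Probability.RandomPlanarGeometry.LoopConfigurations
import Literature.Probability.Percolation.CLE6Rerooting
import HarnessLib

/-!
# Soft machine, brick 2: hitting events of random loop collections with compact values are Borel

Crux `Summit.CriticalPhenomena.CardyFormulaZ2.Theses.CardyMagicRigidity.NestingRigidity`
(stmt-CriticalPhenomena-4835), line `positive-cone-weight-doubling`, registered stub `stub_tamePrecompactness`
(the SOFT MACHINE: Aizenman–Burchard tightness ⇒ sequential `d_CN`-subsequential limits presented on `[0,1]`
WITH MEASURABLE CLOSENESS EVENTS).  The limit presentation `X : [0,1] → C` of the machine reads its loops off a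
Borel map into a countable product `ι → LoopSpace E` of Aizenman–Burchard spaces (closed sets of curve classes with
the Hausdorff extended distance — not separable, so hitting events `{L | L ∩ S ≠ ∅}` of closed sets `S` need not be
Borel in general).  The measurability of the closeness events `{d_CN(lattice, X s) ≤ ε}` rests on the topological
facts of this file:

* `SoftMachine.isClosed_inter_setOf_hit` — on a CLOSED family of points whose collections are COMPACT sets of
  curves, hitting a closed set of curves is a closed condition (a compact set and a disjoint closed set are at
  positive `edist`, and Hausdorff-close collections hit a neighbourhood);
* `SoftMachine.isClosed_setOf_isCompact` — collections that are compact sets of curves form a closed subset of the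
  Aizenman–Burchard space over a complete space (Mathlib: `NonemptyCompacts` is closed in `Closeds`), and the
  coordinatewise versions in the product `ι → LoopSpace E` (`isClosed_setOf_forall_isCompact`,
  `isClosed_setOf_forall_mem_isLoop`);
* `SoftMachine.isClosed_setOf_exists_mk_mem` — the loop classes whose unbased loop lies in a closed set of
  unbased loops form a closed set of curve classes (the passage to DKKMO's unbased loops is `1`-Lipschitz);
* `softMachine_measurableSet_preimage_inter_hit` (registered anchor) — hence, for a measurable map `g` into the
  product, the events "`g x` lies in the closed compact-valued family `𝒦` and its `j`-th collection hits
  `F ∩ U`" (`F` closed, `U` open) are measurable.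
-/

noncomputable section

open MeasureTheory Set Filter Metric TopologicalSpace Function
open scoped Topology ENNReal NNReal

namespace Summit.CriticalPhenomena.CardyFormulaZ2.Cruxes.NestingRigidity.PositiveConeWeightDoubling

open Literature.Probability.RandomPlanarGeometry

namespace SoftMachine

variable {E : Type*} [MetricSpace E]

/-! ### Compact-valued collections form a closed family -/

/-- Over a complete space, the loop collections that are COMPACT sets of curve classes form a closed subset of
the Aizenman–Burchard space `LoopSpace E` (they are the empty collection and the range of the closed embedding
`NonemptyCompacts.toCloseds`). -/
theorem isClosed_setOf_isCompact [CompleteSpace E] :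
    IsClosed {L : LoopSpace E | IsCompact (L : Set (CurveClass E))} := by
  have hset : {L : LoopSpace E | IsCompact (L : Set (CurveClass E))} =
      Set.range (NonemptyCompacts.toCloseds : NonemptyCompacts (CurveClass E) → LoopSpace E) ∪ {⊥} := by
    ext L
    simp only [mem_setOf_eq, mem_union, mem_range, mem_singleton_iff]
    constructor
    · intro hL
      by_cases hne : (L : Set (CurveClass E)).Nonempty
      · exact Or.inl ⟨⟨⟨L, hL⟩, hne⟩, Closeds.ext rfl⟩
      · right
        rw [not_nonempty_iff_eq_empty] at hne
        exact Closeds.ext (by rw [hne, Closeds.coe_bot])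
    · rintro (⟨K, rfl⟩ | rfl)
      · exact K.isCompact
      · rw [Closeds.coe_bot]; exact isCompact_empty
  rw [hset]
  exact NonemptyCompacts.isClosedEmbedding_toCloseds.isClosed_range.union isClosed_singleton

variable {ι : Type*}

/-- In the product `ι → LoopSpace E`, the points all of whose coordinates are compact collections form a closed
set. -/
theorem isClosed_setOf_forall_isCompact [CompleteSpace E] :
    IsClosed {y : ι → LoopSpace E | ∀ j, IsCompact (y j : Set (CurveClass E))} := by
  have h : ∀ j : ι, IsClosed ((fun y : ι → LoopSpace E ↦ y j) ⁻¹'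
      {L : LoopSpace E | IsCompact (L : Set (CurveClass E))}) :=
    fun j ↦ (isClosed_setOf_isCompact (E := E)).preimage (continuous_apply j)
  convert isClosed_iInter h using 1
  ext y
  simp

/-- In the product `ι → LoopSpace E`, the points all of whose coordinates consist of loops form a closed set
(coordinatewise `Literature.Probability.Percolation.isClosed_setOf_forall_isLoop`). -/
theorem isClosed_setOf_forall_mem_isLoop :
    IsClosed {y : ι → LoopSpace E | ∀ j, ∀ c ∈ y j, CurveClass.IsLoop c} := by
  have h : ∀ j : ι, IsClosed ((fun y : ι → LoopSpace E ↦ y j) ⁻¹'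
      {L : LoopSpace E | ∀ c ∈ L, CurveClass.IsLoop c}) :=
    fun j ↦ (Literature.Probability.Percolation.isClosed_setOf_forall_isLoop (E := E)).preimage
      (continuous_apply j)
  convert isClosed_iInter h using 1
  ext y
  simp

/-! ### Hitting a closed set is a closed condition on compact-valued closed families -/

/-- **Hitting a closed set of curves is a closed condition on a closed, compact-valued family.**  Let
`p : T → LoopSpace E` be continuous, `𝒦 ⊆ T` closed with `p y` a compact set of curve classes for every `y ∈ 𝒦`, and
`S` a closed set of curve classes.  Then `{y ∈ 𝒦 | p y ∩ S ≠ ∅}` is closed: if `p z` misses `S`, then `p z` and `S`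
are at positive extended distance `r` (`p z` compact), and every `y` with `edist (p y) (p z) < r` misses `S` too. -/
theorem isClosed_inter_setOf_hit {T : Type*} [TopologicalSpace T] {p : T → LoopSpace E} (hp : Continuous p)
    {𝒦 : Set T} (h𝒦 : IsClosed 𝒦) (hcpt : ∀ y ∈ 𝒦, IsCompact (p y : Set (CurveClass E)))
    {S : Set (CurveClass E)} (hS : IsClosed S) :
    IsClosed (𝒦 ∩ {y | ((p y : Set (CurveClass E)) ∩ S).Nonempty}) := by
  rw [← closure_subset_iff_isClosed]
  intro z hz
  have hz𝒦 : z ∈ 𝒦 := h𝒦.closure_subset (closure_mono inter_subset_left hz)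
  refine ⟨hz𝒦, ?_⟩
  by_contra hne
  -- an open neighbourhood of `z` on which `p` misses `S`
  obtain ⟨V, hVo, hzV, hV⟩ : ∃ V : Set T, IsOpen V ∧ z ∈ V ∧
      ∀ y ∈ V, ¬ ((p y : Set (CurveClass E)) ∩ S).Nonempty := by
    by_cases hemp : (p z : Set (CurveClass E)) = ∅
    · refine ⟨p ⁻¹' Metric.eball (p z) 1, Metric.isOpen_eball.preimage hp,
        Metric.mem_eball_self zero_lt_one, fun y hy hhit ↦ ?_⟩
      obtain ⟨x, hx, -⟩ := hhit
      have hlt : hausdorffEDist (p y : Set (CurveClass E)) (p z) < 1 := by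
        have := hy; rwa [mem_preimage, Metric.mem_eball, Closeds.edist_eq] at this
      rw [hemp, Metric.hausdorffEDist_empty ⟨x, hx⟩] at hlt
      exact absurd hlt (by simp)
    · have hdisj : Disjoint (p z : Set (CurveClass E)) S :=
        disjoint_left.2 fun x hx hxS ↦ hne ⟨x, hx, hxS⟩
      obtain ⟨r, hr0, hr⟩ := Metric.exists_pos_forall_lt_edist (hcpt z hz𝒦) hS hdisj
      refine ⟨p ⁻¹' Metric.eball (p z) r, Metric.isOpen_eball.preimage hp,
        Metric.mem_eball_self (by exact_mod_cast hr0), fun y hy hhit ↦ ?_⟩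
      · obtain ⟨x', hx', hx'S⟩ := hhit
        have hlt : hausdorffEDist (p y : Set (CurveClass E)) (p z) < r := by
          have := hy; rwa [mem_preimage, Metric.mem_eball, Closeds.edist_eq] at this
        obtain ⟨x, hx, hxx'⟩ := Metric.exists_edist_lt_of_hausdorffEDist_lt hx' hlt
        have := hr x hx x' hx'S
        rw [edist_comm] at hxx'
        exact absurd (hxx'.trans this) (lt_irrefl _)
  obtain ⟨y, hyV, -, hyhit⟩ := mem_closure_iff.1 hz V hVo hzV
  exact hV y hyV hyhit

/-- Coordinate form in the product `ι → LoopSpace E`: on a closed family `𝒦` of points with compact coordinates,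
"the `j`-th collection hits the closed set `S`" is a closed condition. -/
theorem isClosed_inter_setOf_coord_hit {𝒦 : Set (ι → LoopSpace E)} (h𝒦 : IsClosed 𝒦)
    (hcpt : 𝒦 ⊆ {y | ∀ j, IsCompact (y j : Set (CurveClass E))}) (j : ι) {S : Set (CurveClass E)}
    (hS : IsClosed S) : IsClosed (𝒦 ∩ {y | ((y j : Set (CurveClass E)) ∩ S).Nonempty}) :=
  isClosed_inter_setOf_hit (continuous_apply j) h𝒦 (fun _ hy ↦ hcpt hy j) hS

/-- Measurable form: for a measurable `g : X → (ι → LoopSpace E)` (Borel σ-algebra on the product), a closed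
compact-valued family `𝒦`, a closed `F` and an OPEN `U`, the event "`g x ∈ 𝒦` and its `j`-th collection hits
`F ∩ U`" is measurable (`U` is a countable union of closed sets, `IsOpen.exists_iUnion_isClosed`). -/
theorem measurableSet_preimage_inter_hit {X : Type*} [MeasurableSpace X] [MeasurableSpace (ι → LoopSpace E)]
    [BorelSpace (ι → LoopSpace E)] {g : X → ι → LoopSpace E} (hg : Measurable g)
    {𝒦 : Set (ι → LoopSpace E)} (h𝒦 : IsClosed 𝒦) (hcpt : 𝒦 ⊆ {y | ∀ j, IsCompact (y j : Set (CurveClass E))})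
    (j : ι) {F U : Set (CurveClass E)} (hF : IsClosed F) (hU : IsOpen U) :
    MeasurableSet (g ⁻¹' (𝒦 ∩ {y | ((y j : Set (CurveClass E)) ∩ (F ∩ U)).Nonempty})) := by
  obtain ⟨C, hCc, -, hCU, -⟩ := hU.exists_iUnion_isClosed
  have hset : 𝒦 ∩ {y : ι → LoopSpace E | ((y j : Set (CurveClass E)) ∩ (F ∩ U)).Nonempty} =
      ⋃ n, 𝒦 ∩ {y | ((y j : Set (CurveClass E)) ∩ (F ∩ C n)).Nonempty} := by
    ext y
    simp only [mem_inter_iff, mem_setOf_eq, mem_iUnion, ← hCU]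
    constructor
    · rintro ⟨hy, x, hx, hxF, hxU⟩
      obtain ⟨n, hn⟩ := mem_iUnion.1 hxU
      exact ⟨n, hy, x, hx, hxF, hn⟩
    · rintro ⟨n, hy, x, hx, hxF, hxn⟩
      exact ⟨hy, x, hx, hxF, mem_iUnion.2 ⟨n, hxn⟩⟩
  rw [hset, preimage_iUnion]
  exact MeasurableSet.iUnion fun n ↦
    hg (isClosed_inter_setOf_coord_hit h𝒦 hcpt j (hF.inter (hCc n))).measurableSet

/-! ### From curve classes to DKKMO's unbased loops -/

/-- The loop classes whose unbased loop (`UnbasedLoop.mk (BasedLoop.mk c _)`) lies in a closed set `Q` of unbased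
loops form a closed set of curve classes: loops form a closed set, and the passage to unbased loops does not
increase distances (`BasedLoop.dist_le_dist_toCurveClass`). -/
theorem isClosed_setOf_exists_mk_mem {Q : Set (UnbasedLoop E)} (hQ : IsClosed Q) :
    IsClosed {c : CurveClass E | ∃ h : c.IsLoop, UnbasedLoop.mk (BasedLoop.mk c h) ∈ Q} := by
  rw [← closure_subset_iff_isClosed]
  intro c hc
  have hloop : c.IsLoop := by
    refine CurveClass.isClosed_setOf_isLoop.closure_subset (closure_mono ?_ hc)
    rintro c' ⟨h, -⟩
    exact h
  refine ⟨hloop, ?_⟩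
  rw [← hQ.closure_eq, Metric.mem_closure_iff]
  intro ε hε
  obtain ⟨a, ⟨ha, haQ⟩, hd⟩ := Metric.mem_closure_iff.1 hc ε hε
  refine ⟨_, haQ, ?_⟩
  rw [UnbasedLoop.dist_mk_mk]
  exact (BasedLoop.dist_le_dist_toCurveClass _ _).trans_lt hd

/-- The curve classes with trace NOT contained in a closed set form an open set (`CurveClass.isClosed_rangeSubset`). -/
theorem isOpen_setOf_not_range_subset {A : Set E} (hA : IsClosed A) :
    IsOpen {c : CurveClass E | ¬ c.range ⊆ A} :=
  (CurveClass.isClosed_rangeSubset hA).isOpen_compl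

/-- The curve classes with trace inside an OPEN set form an open set (`CurveClass.isClosed_hitsBefore_empty_right`:
traces are compact). -/
theorem isOpen_setOf_range_subset {U : Set E} (hU : IsOpen U) : IsOpen {c : CurveClass E | c.range ⊆ U} := by
  have h := CurveClass.isClosed_hitsBefore_empty_right (E := E) hU.isClosed_compl
  rw [CurveClass.hitsBefore_empty_right, compl_compl] at h
  simpa [CurveClass.rangeSubset] using h.isOpen_compl

end SoftMachine

/-- **Registered anchor** (`softMachine_measurableSet_preimage_inter_hit`): for a Borel map `g : X → (ι → LoopSpace ℂ)`
into a countable product of Aizenman–Burchard spaces, a closed family `𝒦` of points with compact coordinates, an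
index `j`, a closed set `Q` of unbased loops, a closed `F` and an open `U` of curve classes, the event "`g x ∈ 𝒦` and
the `j`-th collection of `g x` contains a loop class in `F ∩ U` whose unbased loop lies in `Q`" is measurable — the
atom of the measurability of the closeness events `{d_CN(lattice, X s) ≤ ε}` of the soft machine's limit
presentations. -/
theorem softMachine_measurableSet_preimage_inter_hit : ∀ (ι X : Type) [MeasurableSpace X]
    [MeasurableSpace (ι → LoopSpace ℂ)] [BorelSpace (ι → LoopSpace ℂ)] (g : X → ι → LoopSpace ℂ)
    (𝒦 : Set (ι → LoopSpace ℂ)) (j : ι) (Q : Set (UnbasedLoop ℂ)) (F U : Set (CurveClass ℂ)),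
    Measurable g → IsClosed 𝒦 → 𝒦 ⊆ {y | ∀ j, IsCompact (y j : Set (CurveClass ℂ))} → IsClosed Q →
    IsClosed F → IsOpen U →
    MeasurableSet (g ⁻¹' (𝒦 ∩ {y | ∃ c ∈ (y j : Set (CurveClass ℂ)), c ∈ F ∧ c ∈ U ∧
      ∃ h : c.IsLoop, UnbasedLoop.mk (BasedLoop.mk c h) ∈ Q})) := by
  intro ι X _ _ _ g 𝒦 j Q F U hg h𝒦 hcpt hQ hF hU
  have hset : 𝒦 ∩ {y : ι → LoopSpace ℂ | ∃ c ∈ (y j : Set (CurveClass ℂ)), c ∈ F ∧ c ∈ U ∧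
      ∃ h : c.IsLoop, UnbasedLoop.mk (BasedLoop.mk c h) ∈ Q} =
      𝒦 ∩ {y | ((y j : Set (CurveClass ℂ)) ∩
        ((F ∩ {c : CurveClass ℂ | ∃ h : c.IsLoop, UnbasedLoop.mk (BasedLoop.mk c h) ∈ Q}) ∩ U)).Nonempty} := by
    ext y
    simp only [mem_inter_iff, mem_setOf_eq]
    refine and_congr_right fun _ ↦ ⟨?_, ?_⟩
    · rintro ⟨c, hc, hF, hU, h⟩
      exact ⟨c, hc, ⟨hF, h⟩, hU⟩
    · rintro ⟨c, hc, ⟨hF, h⟩, hU⟩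
      exact ⟨c, hc, hF, hU, h⟩
  rw [hset]
  exact SoftMachine.measurableSet_preimage_inter_hit hg h𝒦 hcpt j
    (hF.inter (SoftMachine.isClosed_setOf_exists_mk_mem hQ)) hU

end Summit.CriticalPhenomena.CardyFormulaZ2.Cruxes.NestingRigidity.PositiveConeWeightDoubling

end
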